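import Summits.CriticalPhenomena.PercolationContinuityZ3.Theorems.PercNearOneGluingNoHeavyQuantTwoBigJCert
import Summits.CriticalPhenomena.PercolationContinuityZ3.Theorems.PercNearOneGluingNoHeavyQuantDIBStarScope
import HarnessLib

/-!
# QUANT lane R8 — the typed row `DIBStar x` COMPLETELY DECIDED: `DIBStar x ↔ x ≤ 1`

builds on p205010 (kernel theorem, internal audit signed; external expert review pending)

Support file (`--supports stmt-CriticalPhenomena-4575`), QUANT lane seat prim-quant-p1 (gen 13).  Theorems only; no sorries, standard axioms.
`dibStar_holds_J` (`…QuantTwoBigJCert`, p292639: every floor `x < 1`) + `dibStar_one` / `not_dibStar_of_one_lt` (`…QuantDIBStarScope`: the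
floor `1` holds, every floor `> 1` fails) give the exact scope of Conjecture DIB\* as typed:

* `Quant.IndepBlob.dibStar_of_le_one` — `DIBStar x` for every `x ≤ 1`.
* **`Quant.IndepBlob.dibStar_iff_le_one : DIBStar x ↔ x ≤ 1`.**  [this work]
-/

namespace Summit.CriticalPhenomena.PercolationContinuityZ3.Theorems
namespace Quant
namespace IndepBlob

/-- **Conjecture DIB\* holds at every floor `x ≤ 1`.** [this work] -/
theorem dibStar_of_le_one (x : ℝ) (hx : x ≤ 1) : DIBStar x := by
  rcases lt_or_eq_of_le hx with h | h
  · exact dibStar_holds_J x h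
  · rw [h]; exact dibStar_one

/-- **The typed row `DIBStar x` holds exactly for `x ≤ 1`.** [this work] -/
theorem dibStar_iff_le_one (x : ℝ) : DIBStar x ↔ x ≤ 1 :=
  ⟨fun h => not_lt.1 fun hx => not_dibStar_of_one_lt hx h, dibStar_of_le_one x⟩

end IndepBlob
end Quant
end Summit.CriticalPhenomena.PercolationContinuityZ3.Theorems
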